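import Literature.RingTheory.CentralSimple.HyperbolicQuadraticPairDiscriminant
import Mathlib.Algebra.Polynomial.Roots
import HarnessLib

/-!
# The rank of an idempotent endomorphism read off a factorisation of its characteristic polynomial
# (Kottwitz' determinant condition ⇒ the Lie signature of a block)

Topic `Literature/LinearAlgebra`; namespace `Literature.LinearAlgebra`.  THEOREMS ONLY (no definition, no named fact, no instance, no notation,
no `sorry`).  Cell `hodgecm-mathlib` (D-0151), FLOOR 0, P6 «MOD programme» (crux hLiu418 = stmt-HodgeConjecture-24832, `--supports`): organ
**(S-T-A) «KOTTWITZ CONDITION ⇒ LIE SIGNATURE OF THE BLOCK»** of the GEN lane (socket (S-T) `hsig` of the K∕BT desk's line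
`Cruxes/HLiu418/Lines/F0_P6d_BlockDocking.lean`; A-p18 (g30), 2026-09-01).  The use: at a special point `x̄` the block idempotent `e_w = ι(a₁)`
acts on the cotangent (or Lie) space of `A_x̄` as an honest idempotent (`a₁² ≡ a₁ mod p`, `char κ̄ = p`; ★ DEAL 11 `RingActionCotangentMapModP`),
and Kottwitz' determinant condition hands its characteristic polynomial as a product `∏_τ (X − τ(a₁)‾)^{r_τ}` over the embeddings
`τ : F → ℚ̄` with the signature multiplicities `r_τ`, where `τ(a₁)‾ = 1` exactly when `τ` induces the place of the block and `= 0`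
otherwise; the rank of `e_w` — the `hsig` socket (`= 1`, ★ DEAL 6∕11 token `Module.finrank k (LinearMap.range (cotangentMap …))`) — is then
the sum of the `r_τ` over those `τ`.  Pure linear algebra over a field:

* §1 `rootMultiplicity_prod_X_sub_C_pow` — `mult_a ∏_{i∈s} (X − c_i)^{m_i} = Σ_{i ∈ s, c_i = a} m_i`.
* §2 **`finrank_range_eq_rootMultiplicity_one_charpoly`** (and `finrank_ker_eq_rootMultiplicity_zero_charpoly`) — for an idempotent `E`:
  `rk E = mult₁ χ_E`, `dim Ker E = mult₀ χ_E` (★ `charpoly_of_isIdempotentElem`: `χ_E = (X−1)^{rk E} X^{dim Ker E}`).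
* §3 **`finrank_range_eq_sum_of_charpoly_eq_prod`** — `χ_E = ∏_{i∈s} (X − c_i)^{m_i}` ⇒ `rk E = Σ_{c_i = 1} m_i`; and the socket form
  **`finrank_range_eq_one_of_charpoly_eq_prod`** (`Σ_{c_i = 1} m_i = 1 ⇒ rk E = 1`).

HC_CM is proved only modulo the printed citations until rung 0 closes; this file is generic and changes no count.

THE PRINT.  [Kottwitz1992] §5 p. 390 (the determinant condition `det(T − ι(b) | Lie A) = ∏_τ (T − τ(b))^{r_τ}`); [RapoportSmithlingZhang2020Diagonal]
§4.1 p. 17 (signature `(1, n−1)` at one place, `(0, n)` at the others — the block of `Lie` at the distinguished place is a line); [KnusEtAl1998] §7.B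
(7.9) (characteristic polynomial of an idempotent), as in ★ `HyperbolicQuadraticPairDiscriminant`.

## References
* [Kottwitz1992] R. Kottwitz, *Points on some Shimura varieties over finite fields*, JAMS 5 (1992), §5 (p. 390).
* [RapoportSmithlingZhang2020Diagonal] M. Rapoport, B. Smithling, W. Zhang, *Arithmetic diagonal cycles on unitary Shimura varieties*, Compos.
  Math. 156 (2020), §4.1 (p. 17).
* [KnusEtAl1998] M.-A. Knus, A. Merkurjev, M. Rost, J.-P. Tignol, *The Book of Involutions* (1998), §7.B Prop. (7.9).
-/

set_option autoImplicit false

noncomputable section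

open Polynomial Module

namespace Literature.LinearAlgebra

universe u v

/-! ## §1 Root multiplicities of a product of powers of linear factors -/

/-- **`mult_a ∏_{i∈s} (X − c_i)^{m_i} = Σ_{i ∈ s, c_i = a} m_i`** over a domain. [cite: KnusEtAl1998, §7.B (7.9)] -/
theorem rootMultiplicity_prod_X_sub_C_pow {R : Type u} [CommRing R] [IsDomain R] [DecidableEq R] {ι : Type v} [DecidableEq ι]
    (s : Finset ι) (c : ι → R) (m : ι → ℕ) (a : R) :
    (∏ i ∈ s, (X - C (c i)) ^ m i).rootMultiplicity a = ∑ i ∈ s with c i = a, m i := by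
  induction s using Finset.induction_on with
  | empty => simp
  | insert j s hj ih =>
    rw [Finset.prod_insert hj, Finset.filter_insert, rootMultiplicity_mul, ih]
    · by_cases hja : c j = a
      · rw [if_pos hja, Finset.sum_insert (fun h => hj (Finset.mem_of_mem_filter j h)), hja, rootMultiplicity_X_sub_C_pow]
      · rw [if_neg hja, rootMultiplicity_eq_zero, zero_add]
        intro hroot
        rw [IsRoot, eval_pow, eval_sub, eval_X, eval_C] at hroot
        rcases Nat.eq_zero_or_pos (m j) with h0 | hpos
        · rw [h0, pow_zero] at hroot
          exact one_ne_zero hroot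
        · exact hja (sub_eq_zero.mp ((pow_eq_zero_iff hpos.ne').mp hroot)).symm
    · exact mul_ne_zero (pow_ne_zero _ (X_sub_C_ne_zero _))
        (Finset.prod_ne_zero_iff.2 fun i _ => pow_ne_zero _ (X_sub_C_ne_zero _))

/-! ## §2 The rank of an idempotent from its characteristic polynomial -/

variable {K : Type u} [Field K] {V : Type v} [AddCommGroup V] [Module K V] [FiniteDimensional K V]

/-- **`rk E = mult₁ χ_E`** for an idempotent endomorphism `E` of a finite-dimensional vector space (`χ_E = (X − 1)^{rk E} X^{dim Ker E}`,
★ `charpoly_of_isIdempotentElem`). [cite: KnusEtAl1998, §7.B Prop. (7.9)] -/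
theorem finrank_range_eq_rootMultiplicity_one_charpoly {E : Module.End K V} (hE : IsIdempotentElem E) :
    finrank K (LinearMap.range E) = E.charpoly.rootMultiplicity 1 := by
  rw [Literature.RingTheory.CentralSimple.HyperbolicQuadraticPairDiscriminant.charpoly_of_isIdempotentElem hE]
  have h1 : (X : K[X]) - 1 = X - C 1 := by rw [map_one]
  rw [h1, rootMultiplicity_mul (mul_ne_zero (pow_ne_zero _ (X_sub_C_ne_zero 1)) (pow_ne_zero _ X_ne_zero)),
    rootMultiplicity_X_sub_C_pow, rootMultiplicity_eq_zero, add_zero]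
  intro hroot
  rw [IsRoot, eval_pow, eval_X, one_pow] at hroot
  exact one_ne_zero hroot

/-- **`dim Ker E = mult₀ χ_E`** for an idempotent `E`. [cite: KnusEtAl1998, §7.B Prop. (7.9)] -/
theorem finrank_ker_eq_rootMultiplicity_zero_charpoly {E : Module.End K V} (hE : IsIdempotentElem E) :
    finrank K (LinearMap.ker E) = E.charpoly.rootMultiplicity 0 := by
  rw [Literature.RingTheory.CentralSimple.HyperbolicQuadraticPairDiscriminant.charpoly_of_isIdempotentElem hE]
  have h1 : (X : K[X]) - 1 = X - C 1 := by rw [map_one]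
  have hX : ((X : K[X]) ^ finrank K (LinearMap.ker E)).rootMultiplicity 0 = finrank K (LinearMap.ker E) := by
    simpa using rootMultiplicity_X_sub_C_pow (0 : K) (finrank K (LinearMap.ker E))
  rw [h1, rootMultiplicity_mul (mul_ne_zero (pow_ne_zero _ (X_sub_C_ne_zero 1)) (pow_ne_zero _ X_ne_zero)), hX,
    rootMultiplicity_eq_zero, zero_add]
  intro hroot
  rw [IsRoot, eval_pow, eval_sub, eval_X, eval_C, zero_sub] at hroot
  exact pow_ne_zero _ (neg_ne_zero.mpr (one_ne_zero (α := K))) hroot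

/-! ## §3 Kottwitz' form: the rank from a product decomposition of `χ_E` -/

/-- **`χ_E = ∏_{i∈s} (X − c_i)^{m_i}` ⇒ `rk E = Σ_{i ∈ s, c_i = 1} m_i`** for an idempotent `E` — in the use `E = ι(a₁)|_{Lie A_x̄}`, `i = τ` runs
over the embeddings of `F`, `c_τ = τ(a₁) mod 𝔪 ∈ {0, 1}` and `m_τ = r_τ` is Kottwitz' signature. [cite: Kottwitz1992, §5 (p. 390)]
[cite: KnusEtAl1998, §7.B Prop. (7.9)] -/
theorem finrank_range_eq_sum_of_charpoly_eq_prod [DecidableEq K] {E : Module.End K V} (hE : IsIdempotentElem E) {ι : Type*} [DecidableEq ι]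
    (s : Finset ι) (c : ι → K) (m : ι → ℕ) (hχ : E.charpoly = ∏ i ∈ s, (X - C (c i)) ^ m i) :
    finrank K (LinearMap.range E) = ∑ i ∈ s with c i = 1, m i := by
  rw [finrank_range_eq_rootMultiplicity_one_charpoly hE, hχ, rootMultiplicity_prod_X_sub_C_pow]

/-- **THE SOCKET FORM: `Σ_{c_i = 1} m_i = 1 ⇒ rk E = 1`** — «signature `(1, n − 1)` at exactly one embedding inducing the place of the block,
`(0, n)` at the others» makes the block of `Lie` a LINE (the (S-T) `hsig` token once `E` is the cotangent∕Lie action of a lift of `e_w`,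
★ DEAL 11 `hsig_of_one`). [cite: RapoportSmithlingZhang2020Diagonal, §4.1 (p. 17)] [cite: Kottwitz1992, §5 (p. 390)] -/
theorem finrank_range_eq_one_of_charpoly_eq_prod [DecidableEq K] {E : Module.End K V} (hE : IsIdempotentElem E) {ι : Type*} [DecidableEq ι]
    (s : Finset ι) (c : ι → K) (m : ι → ℕ) (hχ : E.charpoly = ∏ i ∈ s, (X - C (c i)) ^ m i)
    (h1 : ∑ i ∈ s with c i = 1, m i = 1) : finrank K (LinearMap.range E) = 1 := by
  rw [finrank_range_eq_sum_of_charpoly_eq_prod hE s c m hχ, h1]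

end Literature.LinearAlgebra
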